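import Summits.Ventures.HSemireg.WedgeHankelRecurrenceGaussNodesLaguerreBound

/-!
# Venture HSemireg — **THE ZEROS OF THE SECOND-KIND (NUMERATOR) POLYNOMIAL SEPARATE THOSE OF THE DENOMINATOR**: for a positive recurrence with second-kind polynomials `r` (`r_0 = 0`, `r_1 = 1`), if
# `q_{m+2} = ∏_k (X − y_k)` with `y_0 < ⋯ < y_{m+1}`, then `r_{m+2} = ∏_k (X − ρ_k)` with `y_k < ρ_k < y_{k+1}` (`k ≤ m`): the `m + 1` poles and zeros of the Padé approximant
# `r_{m+2} ∕ q_{m+2}` of the Stieltjes transform strictly interlace (the Casoratian `q_{m+1} r_{m+2} − q_{m+2} r_{m+1} = b_1 ⋯ b_{m+1} > 0` at the `y_k`)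

HONEST FRAMING. Part of the Lean index of the computation cell `pub-hsemireg` (seat p10 gen 43, Sunday typer «UNIFORM-IN-n»).  Real polynomials and the intermediate value theorem (the tree's
`exists_root_Ioo_of_mul_eval_neg`) only; no variety, no cohomology theory, no sheaf, no Ext group and no semiregularity map is constructed here; nothing here says that HC / HC_CM / HC_AV holds; no
Literature fact (unproved `Prop`) is declared or used.  Custodian versions as in `WedgeHankelSiegelIdeal` (1/3).
SOURCES (cited).  G. Szegő, *Orthogonal Polynomials*, Thm 3.3.5 (the zeros of the numerators of the convergents separate those of the denominators) and §3.5; T. J. Stieltjes, *Recherches sur les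
fractions continues* (1894), §§ 9–11; T. S. Chihara, *An Introduction to Orthogonal Polynomials* (1978), Ch. III Thm 4.3 (numerator polynomials); N. I. Akhiezer, *The Classical Moment Problem*, Ch. I §2–§4;
O. Perron, *Die Lehre von den Kettenbrüchen* II, §§ 1–4.
PROOF TYPED HERE.  At a zero `y_k` of `q_{m+2}`, N281 `recurrence_secondKind_eval_at_zero` gives `q_{m+1}(y_k) r_{m+2}(y_k) = b_1⋯b_{m+1} > 0`; N279 `prod_sub_mul_prod_sub_neg_of_interlace` (zeros of
`q_{m+1}` interlace the `y_k`) gives `q_{m+1}(y_k) q_{m+1}(y_{k+1}) < 0`, hence `r_{m+2}(y_k) r_{m+2}(y_{k+1}) < 0`; the intermediate value theorem puts a zero of `r_{m+2}` in every gap, and degree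
`m + 1` (N284 `secondKind_monic_natDegree`) forces `r_{m+2} = ∏ (X − ρ_k)`.
DEDUP DISCLOSURE (`rg -n 'secondKind_zeros|numerator.*interlace|r .*interlace' Summits/Ventures/HSemireg`, 2026-09-03): N281/N284 have the Casoratian, the residues and the Padé identity; N285 separates
the zeros of `q_m` and `q_n`; the numerator–denominator interlacing is new.  The 2 names below: 0 hits tree-wide.

WHAT IS IN THE TREE.  `exists_root_Ioo_of_mul_eval_neg` (Interlacing); N279 `recurrence_zeros_interlace`, `prod_sub_mul_prod_sub_neg_of_interlace`, `eq_prod_X_sub_C_of_monic_of_roots`,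
`recurrence_monic_natDegree`; N281 `recurrence_secondKind_eval_at_zero`; N284 `secondKind_monic_natDegree`; N294 `strictMono_eq_of_prod_X_sub_C_eq`.
THIS FILE (namespace `Summit.Ventures.HSemireg.Wedge.HankelOuter` continued; CHAINED on N312 (import), N279, N281, N284, N294; 0 definitions):
* §1078 `secondKind_eval_mul_eval_succ_neg` (`r_{m+2}(y_k) r_{m+2}(y_{k+1}) < 0` at consecutive zeros of `q_{m+2}`), **`secondKind_zeros_interlace`** (SZEGŐ 3.3.5: `r_{m+2} = ∏_k (X − ρ_k)` with
  `y_k < ρ_k < y_{k+1}`, `ρ` strictly increasing).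
CAVEATS.  Positive recurrence (`b > 0`).  Nothing Ext-side.  New names only.
-/

open Module Polynomial
open scoped Matrix Polynomial

namespace Summit.Ventures.HSemireg.Wedge.HankelOuter

/-! ## §1078. Szegő's Theorem 3.3.5: numerator zeros separate denominator zeros -/

/-- **`r_{m+2}` alternates in sign along the zeros of `q_{m+2}`**: if `q_{m+2} = ∏_k (X − y_k)` (`y` strictly increasing, positive recurrence), then `r_{m+2}(y_k) r_{m+2}(y_{k+1}) < 0` for `k ≤ m`.
[Szegő Thm 3.3.5 (proof); Stieltjes 1894 §10; this file, §1078] -/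
theorem secondKind_eval_mul_eval_succ_neg {q r : ℕ → ℝ[X]} {a b : ℕ → ℝ} (hq0 : q 0 = 1) (hq1 : q 1 = Polynomial.X - C (a 0))
    (hrec : ∀ n, q (n + 2) = (Polynomial.X - C (a (n + 1))) * q (n + 1) - C (b (n + 1)) * q n) (hr0 : r 0 = 0) (hr1 : r 1 = 1)
    (hrrec : ∀ n, r (n + 2) = (Polynomial.X - C (a (n + 1))) * r (n + 1) - C (b (n + 1)) * r n) (hb : ∀ j, 0 < b j) {m : ℕ} {y : Fin (m + 2) → ℝ}
    (hy : StrictMono y) (hyq : q (m + 2) = ∏ k, (Polynomial.X - C (y k))) (k : Fin (m + 1)) :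
    (r (m + 2)).eval (y k.castSucc) * (r (m + 2)).eval (y k.succ) < 0 := by
  -- the zeros of `q_{m+1}` interlace the `y_k`
  obtain ⟨z, y', hz, hy', hzq, hy'q, hint⟩ := recurrence_zeros_interlace hq0 hq1 hrec hb m
  have hyy : y' = y := strictMono_eq_of_prod_X_sub_C_eq hy' hy (hy'q.symm.trans hyq)
  subst hyy
  have hroot : ∀ i, (q (m + 2)).eval (y' i) = 0 := fun i => by
    rw [hy'q, eval_prod]; exact Finset.prod_eq_zero (Finset.mem_univ i) (by simp)
  have hqz : ∀ x, (q (m + 1)).eval x = ∏ j, (x - z j) := fun x => by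
    rw [hzq, eval_prod]; exact Finset.prod_congr rfl fun j _ => by rw [eval_sub, eval_X, eval_C]
  -- Casoratian at the zeros: `q_{m+1}(y) r_{m+2}(y) = B > 0`
  have hB : 0 < ∏ j ∈ Finset.Ico 1 (m + 2), b j := Finset.prod_pos fun j _ => hb j
  have hcas : ∀ i, (q (m + 1)).eval (y' i) * (r (m + 2)).eval (y' i) = ∏ j ∈ Finset.Ico 1 (m + 2), b j := fun i =>
    recurrence_secondKind_eval_at_zero hq0 hrec hr0 hr1 hrrec (m + 1) (hroot i)
  have hneg := prod_sub_mul_prod_sub_neg_of_interlace hint hy' k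
  rw [← hqz, ← hqz] at hneg
  -- `r(y_k) r(y_{k+1}) = B² / (q(y_k) q(y_{k+1})) < 0`
  have hq1ne : (q (m + 1)).eval (y' k.castSucc) ≠ 0 := fun h => by rw [h, zero_mul] at hneg; exact lt_irrefl _ hneg
  have hq2ne : (q (m + 1)).eval (y' k.succ) ≠ 0 := fun h => by rw [h, mul_zero] at hneg; exact lt_irrefl _ hneg
  have hr1 : (r (m + 2)).eval (y' k.castSucc) = (∏ j ∈ Finset.Ico 1 (m + 2), b j) / (q (m + 1)).eval (y' k.castSucc) := by
    rw [eq_div_iff hq1ne, mul_comm]; exact hcas _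
  have hr2 : (r (m + 2)).eval (y' k.succ) = (∏ j ∈ Finset.Ico 1 (m + 2), b j) / (q (m + 1)).eval (y' k.succ) := by
    rw [eq_div_iff hq2ne, mul_comm]; exact hcas _
  rw [hr1, hr2, div_mul_div_comm]
  exact div_neg_of_pos_of_neg (mul_pos hB hB) hneg

/-- **SZEGŐ'S THEOREM 3.3.5: the zeros of the numerator polynomial `r_{m+2}` separate the zeros of the denominator `q_{m+2}`.**  For a positive recurrence with second-kind polynomials `r` and
`q_{m+2} = ∏_k (X − y_k)` (`y_0 < ⋯ < y_{m+1}`), there is `ρ_0 < ⋯ < ρ_m` with `r_{m+2} = ∏_k (X − ρ_k)` and `y_k < ρ_k < y_{k+1}` for every `k ≤ m`.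
[Szegő Thm 3.3.5; Stieltjes 1894 §§ 9–11; Chihara III Thm 4.3; Perron II §4; this file, §1078] -/
theorem secondKind_zeros_interlace {q r : ℕ → ℝ[X]} {a b : ℕ → ℝ} (hq0 : q 0 = 1) (hq1 : q 1 = Polynomial.X - C (a 0))
    (hrec : ∀ n, q (n + 2) = (Polynomial.X - C (a (n + 1))) * q (n + 1) - C (b (n + 1)) * q n) (hr0 : r 0 = 0) (hr1 : r 1 = 1)
    (hrrec : ∀ n, r (n + 2) = (Polynomial.X - C (a (n + 1))) * r (n + 1) - C (b (n + 1)) * r n) (hb : ∀ j, 0 < b j) {m : ℕ} {y : Fin (m + 2) → ℝ}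
    (hy : StrictMono y) (hyq : q (m + 2) = ∏ k, (Polynomial.X - C (y k))) :
    ∃ ρ : Fin (m + 1) → ℝ, StrictMono ρ ∧ r (m + 2) = ∏ k, (Polynomial.X - C (ρ k)) ∧ ∀ k : Fin (m + 1), y k.castSucc < ρ k ∧ ρ k < y k.succ := by
  have hgap : ∀ k : Fin (m + 1), ∃ x, y k.castSucc < x ∧ x < y k.succ ∧ (r (m + 2)).IsRoot x := fun k =>
    exists_root_Ioo_of_mul_eval_neg (hy (Fin.castSucc_lt_succ (i := k))) (secondKind_eval_mul_eval_succ_neg hq0 hq1 hrec hr0 hr1 hrrec hb hy hyq k)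
  choose ρ hρ1 hρ2 hρ3 using hgap
  have hρ : StrictMono ρ := fun i j hij => by
    have h1 : ρ i < y i.succ := hρ2 i
    have h2 : y j.castSucc < ρ j := hρ1 j
    have h3 : y i.succ ≤ y j.castSucc := hy.monotone (Fin.succ_le_castSucc_iff.2 hij)
    linarith
  have hmd := secondKind_monic_natDegree hr0 hr1 hrrec (m + 1)
  exact ⟨ρ, hρ, eq_prod_X_sub_C_of_monic_of_roots hmd.1 hmd.2 hρ.injective hρ3, fun k => ⟨hρ1 k, hρ2 k⟩⟩

end Summit.Ventures.HSemireg.Wedge.HankelOuter
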